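import Literature.Computability.Cryptography.LWEPrimePowerProgData
import Literature.Computability.Cryptography.LWEPrimePowerLayout
import Literature.Computability.Cryptography.LWEPrimePowerStrategy
import Literature.Computability.Complexity.CodeFPBudgets
import HarnessLib

/-!
# The Micciancio–Peikert machine: polynomial bounds of the schedule

Topic `Computability/Cryptography` (LWE), grouping namespace `LWE.MP12.Prog`. Proved material (no named
fact) towards `Literature.Computability.Cryptography.blprs_gapSVP_sqrt_dim_to_lwe_classical`
(**pqc.S21**), hypothesis `h₂`: closure of `IsPolyBounded` under sums, products, powers and polynomial
post-composition, and the polynomial bounds of every quantity of the schedule — sample counts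
`numSamples`, coin counts `numCoins`, call counts `nCalls`, the coins per call `ellOf`.

## References

* O. Regev, *On lattices, learning with errors, random linear codes, and cryptography*, J. ACM 56 (2009), Thm 1.1 (the regime `poly(n)`). [Regev2009]
-/

noncomputable section

namespace Literature.Computability.Cryptography

namespace LWE

namespace MP12

namespace Prog

open _root_.Computability Polynomial Literature.Computability.Complexity Literature.Computability.Complexity.CodeFP BLPRS2013

/-! ### Closure of `IsPolyBounded` -/

section Closure

variable {f g : ℕ → ℕ}

/-- Pointwise domination preserves polynomial boundedness. [folklore] -/
theorem isPolyBounded_of_le (hg : IsPolyBounded g) (h : ∀ n, f n ≤ g n) : IsPolyBounded f := by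
  obtain ⟨p, hp⟩ := hg
  exact ⟨p, fun n => (h n).trans (hp n)⟩

/-- Constants. [folklore] -/
theorem isPolyBounded_const (C : ℕ) : IsPolyBounded fun _ => C := ⟨Polynomial.C C, fun n => by simp⟩

/-- The identity. [folklore] -/
theorem isPolyBounded_id : IsPolyBounded fun n => n := ⟨X, fun n => by simp⟩

/-- Sums. [folklore] -/
theorem isPolyBounded_add (hf : IsPolyBounded f) (hg : IsPolyBounded g) : IsPolyBounded fun n => f n + g n := by
  obtain ⟨p, hp⟩ := hf
  obtain ⟨q, hq⟩ := hg
  exact ⟨p + q, fun n => by rw [eval_add]; exact Nat.add_le_add (hp n) (hq n)⟩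

/-- Products. [folklore] -/
theorem isPolyBounded_mul (hf : IsPolyBounded f) (hg : IsPolyBounded g) : IsPolyBounded fun n => f n * g n := by
  obtain ⟨p, hp⟩ := hf
  obtain ⟨q, hq⟩ := hg
  exact ⟨p * q, fun n => by rw [eval_mul]; exact Nat.mul_le_mul (hp n) (hq n)⟩

/-- Powers. [folklore] -/
theorem isPolyBounded_pow (hf : IsPolyBounded f) (k : ℕ) : IsPolyBounded fun n => f n ^ k := by
  obtain ⟨p, hp⟩ := hf
  exact ⟨p ^ k, fun n => by rw [eval_pow]; exact Nat.pow_le_pow_left (hp n) k⟩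

/-- Post-composition with a polynomial. [folklore] -/
theorem isPolyBounded_eval (r : Polynomial ℕ) (hf : IsPolyBounded f) : IsPolyBounded fun n => r.eval (f n) := by
  obtain ⟨p, hp⟩ := hf
  exact ⟨r.comp p, fun n => by rw [eval_comp]; exact TM2Iter.eval_mono r (hp n)⟩

/-- Pre-composition with a polynomially bounded function. [folklore] -/
theorem isPolyBounded_comp (hg : IsPolyBounded g) (hf : IsPolyBounded f) : IsPolyBounded fun n => g (f n) := by
  obtain ⟨p, hp⟩ := hg
  exact isPolyBounded_of_le (isPolyBounded_eval p hf) fun n => hp (f n)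

end Closure

/-! ### The schedule -/

section Schedule

variable (c : ℕ) {m₂ : ℕ → ℕ}

/-- `dim n ≤ n`. [folklore] -/
theorem isPolyBounded_dim : IsPolyBounded dim := isPolyBounded_of_le isPolyBounded_id fun n => Nat.sqrt_le_self n

/-- `lev n ≤ n + 2`. [folklore] -/
theorem isPolyBounded_lev : IsPolyBounded lev :=
  isPolyBounded_of_le (isPolyBounded_add isPolyBounded_id (isPolyBounded_const 2)) fun n => by
    unfold lev; have := Nat.sqrt_le_self n; unfold dim; omega

/-- `logK n ≤ n + 1`. [folklore] -/
theorem isPolyBounded_logK : IsPolyBounded logK :=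
  isPolyBounded_of_le (isPolyBounded_add isPolyBounded_id (isPolyBounded_const 1)) fun n => by
    unfold logK; have := Nat.log_le_self 2 n; omega

/-- `aggK` is polynomially bounded. [folklore] -/
theorem isPolyBounded_aggK : IsPolyBounded aggK := isPolyBounded_pow isPolyBounded_logK 4

/-- `invGap c` is polynomially bounded. [folklore] -/
theorem isPolyBounded_invGap : IsPolyBounded (invGap c) := by
  unfold invGap
  exact isPolyBounded_mul (isPolyBounded_mul (isPolyBounded_const 8) isPolyBounded_lev) (isPolyBounded_pow isPolyBounded_id c)

/-- `slack` is polynomially bounded. [folklore] -/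
theorem isPolyBounded_slack : IsPolyBounded slack := by
  unfold slack
  exact isPolyBounded_mul (isPolyBounded_mul (isPolyBounded_const 24) isPolyBounded_dim) isPolyBounded_lev

/-- `trials c` is polynomially bounded. [folklore] -/
theorem isPolyBounded_trials : IsPolyBounded (trials c) := by
  unfold trials
  exact isPolyBounded_mul (isPolyBounded_mul (isPolyBounded_const 2) isPolyBounded_slack) (isPolyBounded_invGap c)

/-- `reps c` is polynomially bounded. [folklore] -/
theorem isPolyBounded_reps : IsPolyBounded (reps c) := by
  unfold reps
  exact isPolyBounded_mul (isPolyBounded_mul (isPolyBounded_mul (isPolyBounded_const 8) (isPolyBounded_trials c)) isPolyBounded_slack)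
    (isPolyBounded_pow (isPolyBounded_invGap c) 2)

/-- `meas c` is polynomially bounded. [folklore] -/
theorem isPolyBounded_meas : IsPolyBounded (meas c) := by
  unfold meas
  exact isPolyBounded_mul (isPolyBounded_mul (isPolyBounded_const 768) (isPolyBounded_pow (isPolyBounded_add isPolyBounded_lev (isPolyBounded_const 1)) 3))
    (isPolyBounded_pow isPolyBounded_id (2 * c))

/-- `extra` is polynomially bounded. [folklore] -/
theorem isPolyBounded_extra : IsPolyBounded extra := by
  unfold extra
  exact isPolyBounded_add isPolyBounded_dim (isPolyBounded_const 4)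

/-- **The sample count `m₁` of the machine is polynomially bounded.** [folklore] -/
theorem isPolyBounded_numSamples (hm₂ : IsPolyBounded m₂) :
    IsPolyBounded fun n => numSamples (dim n) (lev n) (aggK n - 1) (m₂ n) (reps c n) (trials c n) (meas c n) (extra n) := by
  have hK : IsPolyBounded fun n => aggK n - 1 + 1 := isPolyBounded_of_le isPolyBounded_aggK fun n => by have := one_le_aggK n; omega
  unfold numSamples nEs nXs
  refine isPolyBounded_add (isPolyBounded_mul (isPolyBounded_add isPolyBounded_lev (isPolyBounded_const 1))
    (isPolyBounded_mul (isPolyBounded_meas c) (isPolyBounded_mul hm₂ hK))) (isPolyBounded_add ?_ (isPolyBounded_add ?_ isPolyBounded_extra)) <;>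
  exact isPolyBounded_mul isPolyBounded_dim (isPolyBounded_mul isPolyBounded_lev (isPolyBounded_mul (isPolyBounded_const 2)
    (isPolyBounded_mul (isPolyBounded_trials c) (isPolyBounded_mul (isPolyBounded_reps c) (isPolyBounded_mul hm₂ hK)))))

/-- The length bound of the distinguisher's input code is polynomially bounded. [folklore] -/
theorem isPolyBounded_ldataBound (hm₂ : IsPolyBounded m₂) : IsPolyBounded fun n => ldataBound (dim n) (2 ^ lev n) (m₂ n) := by
  have hd : IsPolyBounded fun n => (natE (dim n)).length := isPolyBounded_of_le isPolyBounded_dim fun n => length_natE_le _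
  have hQ : IsPolyBounded fun n => (natE (2 ^ lev n)).length :=
    isPolyBounded_of_le (isPolyBounded_add isPolyBounded_lev (isPolyBounded_const 1)) fun n => (Brick.length_encodeNat_two_pow (lev n)).le
  unfold ldataBound
  refine isPolyBounded_add (isPolyBounded_add (isPolyBounded_mul (isPolyBounded_const 2) hd) (isPolyBounded_const 2))
    (isPolyBounded_add (isPolyBounded_add (isPolyBounded_mul (isPolyBounded_const 2) hQ) (isPolyBounded_const 2))
      (isPolyBounded_add (isPolyBounded_add (isPolyBounded_mul (isPolyBounded_const 2) hm₂) (isPolyBounded_const 2))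
        (isPolyBounded_mul hm₂ (isPolyBounded_add (isPolyBounded_mul (isPolyBounded_const 2) (isPolyBounded_add (isPolyBounded_add
          (isPolyBounded_mul (isPolyBounded_const 8) isPolyBounded_dim) (isPolyBounded_const 6)) (isPolyBounded_mul (isPolyBounded_add
            (isPolyBounded_mul (isPolyBounded_const 4) isPolyBounded_dim) (isPolyBounded_const 1)) hQ))) (isPolyBounded_const 2)))))

/-- **The coins per call are polynomially bounded.** [folklore] -/
theorem isPolyBounded_ellOf (coinsD : Polynomial ℕ) (hm₂ : IsPolyBounded m₂) :
    IsPolyBounded fun n => coinsD.eval (2 * n + 2 + ldataBound (dim n) (2 ^ lev n) (m₂ n)) :=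
  isPolyBounded_eval coinsD (isPolyBounded_add (isPolyBounded_add (isPolyBounded_mul (isPolyBounded_const 2) isPolyBounded_id) (isPolyBounded_const 2))
    (isPolyBounded_ldataBound hm₂))

/-- **The coin count of the layout is polynomially bounded.** [folklore] -/
theorem isPolyBounded_numCoins (coinsD : Polynomial ℕ) (hm₂ : IsPolyBounded m₂) :
    IsPolyBounded fun n => numCoins (dim n) (lev n) (m₂ n) (reps c n) (trials c n) (meas c n)
      (coinsD.eval (2 * n + 2 + ldataBound (dim n) (2 ^ lev n) (m₂ n))) := by
  have hℓ := isPolyBounded_ellOf coinsD hm₂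
  have hX : IsPolyBounded fun n => rX (dim n) (lev n) (m₂ n) (reps c n) (trials c n) := by
    unfold rX
    exact isPolyBounded_mul isPolyBounded_dim (isPolyBounded_mul isPolyBounded_lev (isPolyBounded_mul (isPolyBounded_const 2)
      (isPolyBounded_mul (isPolyBounded_trials c) (isPolyBounded_mul (isPolyBounded_reps c) hm₂))))
  have hS : IsPolyBounded fun n => numScalars (dim n) (lev n) (m₂ n) (reps c n) (trials c n) (meas c n) := by
    unfold numScalars rEl rEs rTau
    refine isPolyBounded_add (isPolyBounded_mul (isPolyBounded_add isPolyBounded_lev (isPolyBounded_const 1)) (isPolyBounded_mul (isPolyBounded_meas c) hm₂))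
      (isPolyBounded_add (isPolyBounded_mul (isPolyBounded_add isPolyBounded_lev (isPolyBounded_const 1)) (isPolyBounded_mul (isPolyBounded_meas c) isPolyBounded_dim))
        (isPolyBounded_add hX (isPolyBounded_add hX (isPolyBounded_add hX (isPolyBounded_add hX (isPolyBounded_add hX ?_))))))
    exact isPolyBounded_mul isPolyBounded_dim (isPolyBounded_mul isPolyBounded_lev (isPolyBounded_mul (isPolyBounded_const 2)
      (isPolyBounded_mul (isPolyBounded_trials c) isPolyBounded_dim)))
  have hcX : IsPolyBounded fun n => cX (dim n) (lev n) (reps c n) (trials c n) (coinsD.eval (2 * n + 2 + ldataBound (dim n) (2 ^ lev n) (m₂ n))) := by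
    unfold cX
    exact isPolyBounded_mul isPolyBounded_dim (isPolyBounded_mul isPolyBounded_lev (isPolyBounded_mul (isPolyBounded_const 2)
      (isPolyBounded_mul (isPolyBounded_trials c) (isPolyBounded_mul (isPolyBounded_reps c) hℓ))))
  unfold numCoins numCallBits cE
  exact isPolyBounded_add (isPolyBounded_mul hS isPolyBounded_lev) (isPolyBounded_add (isPolyBounded_mul (isPolyBounded_add isPolyBounded_lev
    (isPolyBounded_const 1)) (isPolyBounded_mul (isPolyBounded_meas c) hℓ)) (isPolyBounded_add hcX hcX))

/-- **The call count is polynomially bounded.** [folklore] -/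
theorem isPolyBounded_nCalls : IsPolyBounded fun n => nCalls (dim n) (lev n) 2 (trials c n) (reps c n) (meas c n) := by
  unfold nCalls nEst nDig
  exact isPolyBounded_add (isPolyBounded_mul (isPolyBounded_add isPolyBounded_lev (isPolyBounded_const 1)) (isPolyBounded_meas c))
    (isPolyBounded_mul isPolyBounded_dim (isPolyBounded_mul isPolyBounded_lev (isPolyBounded_mul (isPolyBounded_const 2)
      (isPolyBounded_mul (isPolyBounded_trials c) (isPolyBounded_mul (isPolyBounded_const 2) (isPolyBounded_reps c))))))

end Schedule

end Prog

end MP12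

end LWE

end Literature.Computability.Cryptography

end
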